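import Mathlib
import Literature.Analysis.FluidPDE.TypeIAncientMild
import Literature.Analysis.FluidPDE.OseenSlice
import Literature.Analysis.FluidPDE.NSBoundedMildSmoothing
import HarnessLib

/-!
# Route SymmetryModuliCount — crux `HelicalEndLiouville` (stmt-NavierStokesRegularity-14062),
# line `vanishing-cell-reynolds`, stub 3: Duhamel representation of the cell oscillation

For a Type I ancient mild field `u ∈ A_C` (`IsTypeIAncientMild C u`), times `s < t < 0`, a
vector `L` and a point `x`, write `Π₀ h (x) := ∫₀¹ h(x + rL) dr` for the cell mean along
`L`, `H := e^{(t-s)Δ}u(s)` (`heatExtension (u s) (t - s)`) and `N(τ, ·) := N_{t-τ}[u(τ), u(τ)]`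
(`oseenSlice (t - τ) (u τ) (u τ)`). We prove the identity

  `u(t,x) − Π₀u(t)(x) = (H(x) − Π₀H(x)) − ∫_{(s,t)} (N(τ,x) − Π₀N(τ,·)(x)) dτ`.

Proof. The Oseen mild identity `u(t,y) = H(y) − ∫_{(s,t)} N(τ,y) dτ`
(`IsTypeIAncientMild.mild_eq_heatExtension`, the Duhamel term `oseenDuhamel 1 s u u t` being
`∫ N` definitionally) is used at `y = x` and integrated in `r` at `y = x + rL`; the only analytic
input is ONE Fubini swap on `[0,1] × (s,t)` for `(r,τ) ↦ N(τ, x + rL)`, justified by joint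
measurability (a globally measurable modification of `u` off the slab,
`ContinuousOn.measurable_piecewise`, and `stronglyMeasurable_oseenSlice_param`) and the envelope
`‖N(τ,y)‖ ≤ C₀ (t−τ)^{-1/2} M²`, `M = C/√(−t)` (`exists_norm_oseenSlice_le`,
`IsTypeIAncientMild.norm_le_of_mem_Ioo`), integrable on `[0,1] × (s,t)`
(`integrableOn_Ioo_rpow_neg_half_sub`). The `r`-integrability of `r ↦ H(x + rL)` follows from
the identity itself (`H = u(t) + ∫N`), that of `r ↦ u(t, x + rL)` from continuity of the slice.
Elementary bookkeeping for the line `vanishing-cell-reynolds` of the crux; no periodicity and no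
`L ≠ 0` is used.

References: Koch–Nadirashvili–Seregin–Šverák, Acta Math. 203 (2009), §4 p. 8 (the mild form
`u = U + B(u,u)`). [KochNadirashviliSereginSverak2009]
-/

noncomputable section

-- the summit and its single sub-problem share the name (CONVENTIONS §1), as in every Theorems file
set_option linter.dupNamespace false

open Set MeasureTheory Function Filter
open Literature.Analysis.FluidPDE
open Literature.Analysis.UnboundedOperators (heatExtension)
open scoped RealInnerProductSpace Topology

namespace Summit.NavierStokesRegularity.NavierStokesRegularity.Theorems

local notation "E3" => EuclideanSpace ℝ (Fin 3)

/-- A Type I ancient mild field (only known to be continuous on the open slab `(-∞,0) × ℝ³`)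
admits a globally jointly measurable modification agreeing with it at all negative times
(extend by `0` off the slab; `ContinuousOn.measurable_piecewise`). [folklore] -/
theorem cellOscRepr_exists_measurable_modification {C : ℝ} {u : ℝ → E3 → E3}
    (hu : IsTypeIAncientMild C u) :
    ∃ v : ℝ → E3 → E3, Measurable (uncurry v) ∧ ∀ τ < 0, v τ = u τ := by
  classical
  refine ⟨curry ((Iio (0:ℝ) ×ˢ (univ : Set E3)).piecewise (uncurry u) 0), ?_,
    fun τ hτ => ?_⟩
  · rw [Function.uncurry_curry]
    exact hu.continuousOn_uncurry.measurable_piecewise continuousOn_const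
      (measurableSet_Iio.prod MeasurableSet.univ)
  · funext y
    change (Iio (0:ℝ) ×ˢ (univ : Set E3)).piecewise (uncurry u) 0 (τ, y) = u τ y
    rw [Set.piecewise_eq_of_mem _ _ _ (mk_mem_prod (show τ ∈ Iio (0:ℝ) from hτ) (mem_univ y))]
    rfl

/-- **Stub 3 (representation of the cell oscillation).** For `u ∈ A_C`, `s < t < 0` and any `L`:
the cell oscillation of `u(t)` equals that of the free term `e^{(t−s)Δ}u(s)` minus the time
integral of the cell oscillations of the Oseen slices `N_{t−τ}[u(τ), u(τ)]` (the mild identity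
`IsTypeIAncientMild.mild_eq_heatExtension` at `x` and at `x + rL`, Fubini on `[0,1] × (s,t)` under
the envelope `C₀(t−τ)^{-1/2}C²/(−t)`). [folklore] -/
theorem stub_cellOscRepr :
    ∀ (C : ℝ) (u : ℝ → E3 → E3), IsTypeIAncientMild C u → ∀ (L : E3) (s t : ℝ), s < t → t < 0 →
      ∀ x : E3,
        u t x - (∫ r in (0:ℝ)..1, u t (x + r • L)) =
          (heatExtension (u s) (t - s) x - ∫ r in (0:ℝ)..1, heatExtension (u s) (t - s) (x + r • L)) -
          ∫ τ in Set.Ioo s t, (oseenSlice (t - τ) (u τ) (u τ) x -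
            ∫ r in (0:ℝ)..1, oseenSlice (t - τ) (u τ) (u τ) (x + r • L)) := by
  intro C u hu L s t hst ht x
  simp only [intervalIntegral.integral_of_le (zero_le_one : (0:ℝ) ≤ 1)]
  -- (1) the uniform bound `M = C/√(-t)` on the window `(s, t)` and the slice envelope
  obtain ⟨C₀, -, hC₀⟩ := exists_norm_oseenSlice_le (E := E3)
  have huM : ∀ τ ∈ Ioo s t, ∀ y, ‖u τ y‖ ≤ C / Real.sqrt (-t) :=
    fun τ hτ y => hu.norm_le_of_mem_Ioo ht hτ y
  have hbound : ∀ τ ∈ Ioo s t, ∀ y, ‖oseenSlice (t - τ) (u τ) (u τ) y‖ ≤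
      C₀ * (t - τ) ^ (-(1 / 2 : ℝ)) * (C / Real.sqrt (-t)) * (C / Real.sqrt (-t)) :=
    fun τ hτ y => hC₀ (sub_pos.2 hτ.2) (huM τ hτ) (huM τ hτ) y
  have henv : IntegrableOn (fun τ : ℝ =>
      C₀ * (t - τ) ^ (-(1 / 2 : ℝ)) * (C / Real.sqrt (-t)) * (C / Real.sqrt (-t))) (Ioo s t) :=
    (((integrableOn_Ioo_rpow_neg_half_sub s t).const_mul C₀).mul_const _).mul_const _
  -- (2) joint measurability through a globally measurable modification
  obtain ⟨v, hv, hvu⟩ := cellOscRepr_exists_measurable_modification hu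
  have hG : StronglyMeasurable (fun q : ℝ × E3 => oseenSlice (t - q.1) (v q.1) (v q.1) q.2) :=
    stronglyMeasurable_oseenSlice_param (c := fun τ : ℝ => t - τ)
      (measurable_const.sub measurable_id) hv hv
  have hvN : ∀ τ ∈ Ioo s t, ∀ y,
      oseenSlice (t - τ) (v τ) (v τ) y = oseenSlice (t - τ) (u τ) (u τ) y :=
    fun τ hτ y => by rw [hvu τ (hτ.2.trans ht)]
  have hae : ∀ᵐ p : ℝ × ℝ ∂(((volume : Measure ℝ).restrict (Ioc (0:ℝ) 1)).prod
      ((volume : Measure ℝ).restrict (Ioo s t))), p.2 ∈ Ioo s t :=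
    (Measure.quasiMeasurePreserving_snd (μ := (volume : Measure ℝ).restrict (Ioc (0:ℝ) 1))
      (ν := (volume : Measure ℝ).restrict (Ioo s t))).ae (ae_restrict_mem measurableSet_Ioo)
  -- (3) integrability of `(r, τ) ↦ N(τ, x + rL)` on `[0,1] × (s,t)`
  have hf_meas : AEStronglyMeasurable
      (uncurry fun (r τ : ℝ) => oseenSlice (t - τ) (u τ) (u τ) (x + r • L))
      (((volume : Measure ℝ).restrict (Ioc (0:ℝ) 1)).prod
        ((volume : Measure ℝ).restrict (Ioo s t))) := by
    have h1 : StronglyMeasurable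
        (fun p : ℝ × ℝ => oseenSlice (t - p.2) (v p.2) (v p.2) (x + p.1 • L)) :=
      hG.comp_measurable (g := fun p : ℝ × ℝ => (p.2, x + p.1 • L))
        (measurable_snd.prodMk ((measurable_fst.smul measurable_const).const_add x))
    refine h1.aestronglyMeasurable.congr (hae.mono fun p hp => ?_)
    simp only [uncurry, hvN p.2 hp]
  have hf_int : Integrable
      (uncurry fun (r τ : ℝ) => oseenSlice (t - τ) (u τ) (u τ) (x + r • L))
      (((volume : Measure ℝ).restrict (Ioc (0:ℝ) 1)).prod
        ((volume : Measure ℝ).restrict (Ioo s t))) := by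
    refine ((integrable_const (1 : ℝ)).mul_prod henv).mono' hf_meas (hae.mono fun p hp => ?_)
    rw [one_mul]
    exact hbound p.2 hp _
  -- (4) Fubini and the two marginals
  have hswap :
      ∫ r in Ioc (0:ℝ) 1, ∫ τ in Ioo s t, oseenSlice (t - τ) (u τ) (u τ) (x + r • L) =
        ∫ τ in Ioo s t, ∫ r in Ioc (0:ℝ) 1,
          oseenSlice (t - τ) (u τ) (u τ) (x + r • L) :=
    integral_integral_swap hf_int
  have hD_i : IntegrableOn
      (fun r : ℝ => ∫ τ in Ioo s t, oseenSlice (t - τ) (u τ) (u τ) (x + r • L))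
      (Ioc (0:ℝ) 1) :=
    hf_int.integral_prod_left
  have hNavg_i : IntegrableOn
      (fun τ : ℝ => ∫ r in Ioc (0:ℝ) 1, oseenSlice (t - τ) (u τ) (u τ) (x + r • L))
      (Ioo s t) :=
    hf_int.integral_prod_right
  have hNx_i : IntegrableOn (fun τ => oseenSlice (t - τ) (u τ) (u τ) x) (Ioo s t) := by
    have h1 : IntegrableOn (fun τ => oseenSlice (t - τ) (v τ) (v τ) x) (Ioo s t) := by
      refine henv.mono'
        (hG.comp_measurable (g := fun τ : ℝ => (τ, x))
          (measurable_id.prodMk measurable_const)).aestronglyMeasurable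
        (ae_restrict_of_forall_mem measurableSet_Ioo fun τ hτ => ?_)
      simp only [hvN τ hτ]
      exact hbound τ hτ x
    exact h1.congr_fun (by intro τ hτ; exact hvN τ hτ x) measurableSet_Ioo
  have hu_i : IntegrableOn (fun r => u t (x + r • L)) (Ioc (0:ℝ) 1) :=
    ((hu.continuous_slice ht).comp
      (continuous_const.add (continuous_id.smul continuous_const))).integrableOn_Ioc
  -- (5) the mild identity `u(t) = H - ∫ N` and the algebra
  have hmild : ∀ y, u t y = heatExtension (u s) (t - s) y -
      ∫ τ in Ioo s t, oseenSlice (t - τ) (u τ) (u τ) y := by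
    intro y
    have h := hu.mild_eq_heatExtension hst ht y
    simp only [oseenDuhamel, one_mul] at h
    exact h
  have hH_i :
      IntegrableOn (fun r : ℝ => heatExtension (u s) (t - s) (x + r • L)) (Ioc (0:ℝ) 1) := by
    refine (hu_i.add hD_i).congr (Eventually.of_forall fun r => ?_)
    simp only [Pi.add_apply, hmild (x + r • L), sub_add_cancel]
  have e1 : ∫ r in Ioc (0:ℝ) 1, u t (x + r • L) =
      (∫ r in Ioc (0:ℝ) 1, heatExtension (u s) (t - s) (x + r • L)) -
        ∫ r in Ioc (0:ℝ) 1, ∫ τ in Ioo s t,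
          oseenSlice (t - τ) (u τ) (u τ) (x + r • L) := by
    rw [← integral_sub hH_i hD_i]
    refine integral_congr_ae (Eventually.of_forall fun r => ?_)
    simp only [hmild (x + r • L)]
  have e2 : ∫ τ in Ioo s t, (oseenSlice (t - τ) (u τ) (u τ) x -
        ∫ r in Ioc (0:ℝ) 1, oseenSlice (t - τ) (u τ) (u τ) (x + r • L)) =
      (∫ τ in Ioo s t, oseenSlice (t - τ) (u τ) (u τ) x) -
        ∫ τ in Ioo s t, ∫ r in Ioc (0:ℝ) 1,
          oseenSlice (t - τ) (u τ) (u τ) (x + r • L) :=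
    integral_sub hNx_i hNavg_i
  rw [e1, e2, hmild x, ← hswap]
  abel

end Summit.NavierStokesRegularity.NavierStokesRegularity.Theorems

end
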